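import Literature.AlgebraicGeometry.Resolution.WeightedCentreOneClassLF
import Literature.AlgebraicGeometry.Resolution.WeightedCentreTheoremAPlusClass
import HarnessLib

/-!
# Weighted centres — COROLLARY L-F for a menu with ONE light class (A⁺ discharged)

Instrument for engine 1's `W(f)` TOY MODEL (cell `pub-rosobs`, LF-MODEL-eng1-g45 §6.4 COROLLARY L-F for a single light weight class), NOT a resolution theorem and NOT about
the invariant of [AbramovichTemkinWlodarczyk2024].

`ZKernel.eq_one_of_one_light_class_iso` = `eq_one_of_one_light_class` (`WeightedCentreOneClassLF`, which takes THEOREM A⁺'s output `fixSlots Z` as part of the hypothesis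
`A ∈ isoFix w Z V g`) with that output DISCHARGED by THEOREM A⁺ (`BottomClimb.apply_CX_eq_of_slotPinned_class`, `WeightedCentreTheoremAPlusClass`): for a menu whose light slots
form ONE weight class `Z` of integral weight `r ∈ {1, …, p−1}`, every `A ∈ Iso(N, g) = graded w 1 ⊓ baseFixing ⊓ 𝔄_1 ⊓ fixSlots V ⊓ Stab(C g)` without pure `σ^p`-term on the
`W`-slots is trivial (`k` perfect, `n!·u_n = 1 (n < p)`, positive weights, `g` homogeneous of weight `p(p+1)`, (P) at every slot of weight `≤ p+1`, `V ⊇` the slots heavier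
than `p+1`, all of weight `> p+1`).

References: [AbramovichTemkinWlodarczyk2024, §5.1 (p. 1575), Thm. 5.3.1 (2)–(3) (p. 1578)]; [Lang2002, Ch. I §3, Ch. IV §1, Ch. V §5, Ch. XIII §4]; [Matsumura1987, §27].
-/

namespace Literature.AlgebraicGeometry.Resolution.WeightedBlowup.ZKernel

open Polynomial OrderFiltration LevelProjection Truncation

variable {k : Type*} [Field k] {ι : Type*} [Fintype ι] [DecidableEq ι] (p : ℕ) [Fact p.Prime] [CharP k p] {u : ℕ → k}

/-- **COROLLARY L-F FOR ONE LIGHT CLASS** (LF-MODEL §6.4, `n = 1`): see the module docstring.  Instrument for engine 1's `W(f)` toy model, NOT a resolution theorem.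
[cite: AbramovichTemkinWlodarczyk2024, §5.1 (p. 1575), Thm. 5.3.1 (2)–(3) (p. 1578); Lang2002, Ch. XIII §4; Matsumura1987, §27 (pp. 207–209)] -/
theorem eq_one_of_one_light_class_iso (hperf : ∀ x : k, ∃ y : k, y ^ p = x) (hu : ∀ n < p, (Nat.factorial n : k) * u n = 1)
    {w : ι → ℚ} (hw : ∀ i, 0 < w i) (Z : Set ι) [DecidablePred (· ∈ Z)] (hZ : ∀ j, j ∈ Z ↔ w j < p)
    {r : ℕ} (hr1 : 1 ≤ r) (hrp : r ≤ p - 1) (hZr : ∀ z ∈ Z, w z = r)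
    {g : MvPolynomial ι k} (hg : MvPolynomial.IsWeightedHomogeneous w g ((p : ℚ) * (p + 1))) (hP : ∀ l, w l ≤ (p : ℚ) + 1 → SlotPinned w l g)
    {V : Set ι} (hVw : ∀ i, w i ≤ (p : ℚ) + 1 ∨ i ∈ V) (hwV : ∀ i ∈ V, (p : ℚ) + 1 < w i)
    {A : (MvPolynomial ι k)[X] ≃+* (MvPolynomial ι k)[X]} (hgr : A ∈ graded w (1 : ℚ)) (hb : A ∈ baseFixing) (h1 : A ∈ level (X : (MvPolynomial ι k)[X]) 1)
    (hV : A ∈ fixSlots V) (hfix : A (C g) = C g)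
    (hW : ∀ n, w n = p → pureCoeff (A : (MvPolynomial ι k)[X] →+* (MvPolynomial ι k)[X]) n p = 0) : A = 1 := by
  have hp1 : 1 < p := (Fact.out : p.Prime).one_lt
  have hrq : (0 : ℚ) < r := by exact_mod_cast hr1
  have hrp' : (r : ℚ) < p := by
    have h : r < p := by omega
    exact_mod_cast h
  -- THEOREM A⁺ (class form): `A` fixes every slot of the light class `Z`
  have hZfix : A ∈ fixSlots (k := k) Z := fun z hz => by
    by_cases hZne : ∃ l, l ∈ Z
    · obtain ⟨l, hl⟩ := hZne
      have hmin : ∀ j, w l ≤ w j := fun j => by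
        by_cases hj : j ∈ Z
        · rw [hZr l hl, hZr j hj]
        · rw [hZr l hl]
          exact le_trans hrp'.le (not_lt.mp fun h => hj ((hZ j).mpr h))
      have hlp : w l ≤ (p : ℚ) + 1 := by rw [hZr l hl]; linarith
      exact BottomClimb.apply_CX_eq_of_slotPinned_class hu (fun i => (hw i).le) hVw hgr hb h1 hV hfix hmin (hZr l hl) hr1 hrp (hP l hlp)
        (by rw [hZr z hz, hZr l hl])
    · exact absurd ⟨z, hz⟩ hZne
  let A' : isoFix w Z V g := ⟨A, ⟨⟨⟨⟨⟨hgr, hb⟩, h1⟩, hZfix⟩, hV⟩, MulAction.mem_stabilizer_iff.mpr hfix⟩⟩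
  have hA' : A' = 1 := eq_one_of_one_light_class p hperf hu hw Z hZ hrq (fun z hz => (hZr z hz).ge) hg hP hVw hwV A' hW
  exact congrArg Subtype.val hA'

end Literature.AlgebraicGeometry.Resolution.WeightedBlowup.ZKernel
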